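import Literature.Analysis.Asymptotics.LogPowerScale

/-!
# Route ValuedFieldSpecialisation — crux `ParametricLifting` (stmt-KontsevichZagierPeriods-3498),
line `registered`/birth, stub S2b `stub_divergentMonomials_coeff_eq_zero`: GROUPED COEFFICIENTS OF
DIVERGENT LOG-POWER MONOMIALS VANISH

If a finite real combination `∑ i, w i * s^(a i) * (log s)^(b i)` of divergent monomials
(`a i < 0`, or `a i = 0 ∧ 0 < b i`) has a finite limit along a non-trivial filter
`l ≤ 𝓝[>] 0`, then for every exponent pair the total coefficient of that monomial is `0`
(dominant-monomial induction, cf.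
`Literature.Analysis.Asymptotics.eq_zero_of_tendsto_sum_divergentMonomials`;
Kaiser 2017, Lemma 4.6 / Prop. 4.7). Helper (`--supports`) for item
stmt-KontsevichZagierPeriods-3498.

The proof is the dominant-monomial strong induction of
`Literature.Analysis.Asymptotics.eq_zero_of_tendsto_sum_divergentMonomials` (file
`Literature/Analysis/Asymptotics/LogPowerScale.lean`), run along the sub-filter `l` (every
comparison limit at `0⁺` restricts to `l` by `Filter.Tendsto.mono_left`; uniqueness of limits
along `l` is where `l.NeBot` enters), with the STRONGER induction invariant "every grouped
coefficient vanishes" in place of "the limit is `0`": the total coefficient of the dominant group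
(least `a`, then largest `b`) vanishes, so removing the dominant group does not change the
function, and the remaining groups are handled by the induction hypothesis (the limit `c` stays
the same throughout).

Sources: T. Kaiser, *Lebesgue measure and integration theory on non-archimedean real closed fields
with archimedean value group*, Proc. LMS 116 (2017), §4, Lemma 4.6, Prop. 4.7 (the
dominant-exponent argument, there over the field of real Puiseux series); G. Comte, J.-M. Lion,
J.-P. Rolin, Illinois J. Math. 44 (2000) (the log-power scale of parametric volumes).
-/

noncomputable section

namespace Summit.KontsevichZagierPeriods.ValuedFieldSpecialisation

open Set Filter
open scoped Topology
open Literature.Analysis.Asymptotics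

/-- **Grouped coefficients of divergent log-power monomials vanish (`Finset`-indexed form).**
If a finite real combination `∑ i ∈ S, w i * s ^ (a i) * (log s) ^ (b i)` of monomials which are
all *divergent* at `0⁺` (`a i < 0`, or `a i = 0` and `0 < b i`) tends to a finite limit `c` along
a non-trivial filter `l ≤ 𝓝[>] 0`, then for every `i₀ ∈ S` the total coefficient
`∑ i ∈ S with (a i, b i) = (a i₀, b i₀), w i` of the monomial of `i₀` is `0`.
Proof: strong induction on `S`; normalise by the dominant monomial (least `a`, then largest `b`),
whose total coefficient must therefore vanish (the normalised sum tends both to `0 * c = 0` and to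
that coefficient along `l`; `tendsto_nhds_unique` uses `l.NeBot`), remove the dominant group — the
remaining sum is the same function, with the same limit `c` — and apply the induction hypothesis
to the other groups (adapted from
`Literature.Analysis.Asymptotics.eq_zero_of_tendsto_sum_divergentMonomials`; the dominant-exponent
argument is Kaiser 2017, Lemma 4.6 / Prop. 4.7). [Kaiser 2017, Prop. 4.7] [folklore] -/
theorem sum_filter_eq_zero_of_tendsto_sum_divergentMonomials_of_le {ι : Type*} {a : ι → ℝ}
    {b : ι → ℕ} {w : ι → ℝ} {c : ℝ} {l : Filter ℝ} [l.NeBot] (hl : l ≤ 𝓝[>] 0) :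
    ∀ S : Finset ι, (∀ i ∈ S, a i < 0 ∨ (a i = 0 ∧ 0 < b i)) →
      Tendsto (fun s : ℝ => ∑ i ∈ S, w i * s ^ (a i) * Real.log s ^ (b i)) l (𝓝 c) →
      ∀ i₀ ∈ S, ∑ i ∈ S.filter (fun i => a i = a i₀ ∧ b i = b i₀), w i = 0 := by
  classical
  intro S
  induction S using Finset.strongInduction with
  | H S ih =>
    intro hab h i₁ hi₁S
    have hne : S.Nonempty := ⟨i₁, hi₁S⟩
    -- the dominant (most divergent) exponent pair `(a₀, b₀)`: least `a`, then largest `b`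
    obtain ⟨a₀, b₀, ⟨i₀, hi₀S, hai₀, hbi₀⟩, hdom⟩ :
        ∃ a₀ : ℝ, ∃ b₀ : ℕ, (∃ i ∈ S, a i = a₀ ∧ b i = b₀) ∧
          ∀ i ∈ S, a₀ < a i ∨ (a i = a₀ ∧ b i ≤ b₀) := by
      obtain ⟨j₁, hj₁, ha₁⟩ := S.exists_min_image a hne
      have hTne : (S.filter fun j => a j = a j₁).Nonempty :=
        ⟨j₁, Finset.mem_filter.mpr ⟨hj₁, rfl⟩⟩
      obtain ⟨j₂, hj₂, hb₂⟩ := (S.filter fun j => a j = a j₁).exists_max_image b hTne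
      obtain ⟨hj₂S, ha₂⟩ := Finset.mem_filter.mp hj₂
      refine ⟨a j₁, b j₂, ⟨j₂, hj₂S, ha₂, rfl⟩, fun i hi => ?_⟩
      rcases (ha₁ i hi).lt_or_eq with hlt | heq
      · exact Or.inl hlt
      · exact Or.inr ⟨heq.symm, hb₂ i (Finset.mem_filter.mpr ⟨hi, heq.symm⟩)⟩
    have hdiv₀ : a₀ < 0 ∨ (a₀ = 0 ∧ 0 < b₀) := by
      rw [← hai₀, ← hbi₀]; exact hab i₀ hi₀S
    -- the indices carrying the dominant monomial
    set J := S.filter fun j => a j = a₀ ∧ b j = b₀ with hJ_def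
    have hJS : J ⊆ S := Finset.filter_subset _ _
    have hJne : J.Nonempty := ⟨i₀, Finset.mem_filter.mpr ⟨hi₀S, hai₀, hbi₀⟩⟩
    -- the normalising factor `u = 1 / (s ^ a₀ * (log s) ^ b₀)` tends to `0` (along `l`)
    set u : ℝ → ℝ := fun s => s ^ (-a₀) * (Real.log s)⁻¹ ^ b₀ with hu_def
    have hu : Tendsto u l (𝓝 0) :=
      (tendsto_inv_divergentMonomial_nhdsGT_zero hdiv₀).mono_left hl
    -- eventually (along `l`) `0 < s < 1`, so that `log s ≠ 0`
    have hmem : ∀ᶠ s : ℝ in l, 0 < s ∧ s < 1 := hl (Ioo_mem_nhdsGT one_pos)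
    have hrew : ∀ i, ∀ s : ℝ, 0 < s → u s * (s ^ (a i) * Real.log s ^ (b i)) =
        s ^ (a i - a₀) * Real.log s ^ (b i) * (Real.log s)⁻¹ ^ b₀ := by
      intro i s hs
      simp only [hu_def]
      rw [sub_eq_neg_add, Real.rpow_add hs]
      ring
    -- limits (along `l`) of the normalised monomials: `1` on `J`, `0` off `J`
    set L : ι → ℝ := fun i => if a i = a₀ ∧ b i = b₀ then 1 else 0 with hL_def
    have hlim : ∀ i ∈ S,
        Tendsto (fun s => u s * (s ^ (a i) * Real.log s ^ (b i))) l (𝓝 (L i)) := by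
      intro i hi
      by_cases hJi : a i = a₀ ∧ b i = b₀
      · -- dominant index: the normalised monomial is eventually `1`
        obtain ⟨hai, hbi⟩ := hJi
        have hL : L i = 1 := by simp [hL_def, hai, hbi]
        rw [hL]
        have hev : ∀ᶠ s : ℝ in l, u s * (s ^ (a i) * Real.log s ^ (b i)) = 1 := by
          filter_upwards [hmem] with s hs
          have hlog : Real.log s ≠ 0 := (Real.log_neg hs.1 hs.2).ne
          rw [hrew i s hs.1, hai, hbi, sub_self, Real.rpow_zero, one_mul, ← mul_pow,
            mul_inv_cancel₀ hlog, one_pow]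
        exact tendsto_const_nhds.congr' (hev.mono fun s hs => hs.symm)
      · have hL : L i = 0 := by simp [hL_def, hJi]
        rw [hL]
        rcases hdom i hi with hai | ⟨hai, hble⟩
        · -- strictly larger power of `s`
          have key := ((tendsto_rpow_mul_log_pow_nhdsGT_zero (sub_pos.mpr hai) (b i)).mul
            (tendsto_inv_log_nhdsGT_zero.pow b₀)).mono_left hl
          rw [zero_mul] at key
          refine key.congr' ?_
          filter_upwards [hmem] with s hs
          rw [hrew i s hs.1]
        · -- same power of `s`, strictly smaller power of `log s`
          have hbi : b i < b₀ := lt_of_le_of_ne hble fun h => hJi ⟨hai, h⟩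
          have key : Tendsto (fun s : ℝ => (Real.log s)⁻¹ ^ (b₀ - b i)) l (𝓝 0) := by
            simpa [zero_pow (Nat.sub_ne_zero_of_lt hbi)] using
              (tendsto_inv_log_nhdsGT_zero.pow (b₀ - b i)).mono_left hl
          refine key.congr' ?_
          filter_upwards [hmem] with s hs
          have hlog : Real.log s ≠ 0 := (Real.log_neg hs.1 hs.2).ne
          rw [eq_comm, hrew i s hs.1, hai, sub_self, Real.rpow_zero, one_mul,
            ← pow_sub_mul_pow (Real.log s)⁻¹ hbi.le, mul_left_comm, ← mul_pow,
            mul_inv_cancel₀ hlog, one_pow, mul_one]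
    -- hence `u * P → ∑ i ∈ S, w i * L i`, while also `u * P → 0 * c = 0` (along `l`)
    have hsum : Tendsto (fun s => u s * ∑ i ∈ S, w i * s ^ (a i) * Real.log s ^ (b i)) l
        (𝓝 (∑ i ∈ S, w i * L i)) := by
      have := tendsto_finsetSum S fun i hi => (hlim i hi).const_mul (w i)
      refine this.congr fun s => ?_
      rw [Finset.mul_sum]
      exact Finset.sum_congr rfl fun i _ => by ring
    -- the total coefficient of the dominant group vanishes
    have hWJ : ∑ i ∈ J, w i = 0 := by
      have h0 : ∑ i ∈ S, w i * L i = 0 := by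
        have := hu.mul h
        rw [zero_mul] at this
        exact tendsto_nhds_unique hsum this
      rw [hJ_def, Finset.sum_filter]
      simpa [hL_def, mul_ite] using h0
    -- remove the dominant monomial: the remaining sum is the same function
    have hsplit : ∀ s : ℝ, ∑ i ∈ S \ J, w i * s ^ (a i) * Real.log s ^ (b i) =
        ∑ i ∈ S, w i * s ^ (a i) * Real.log s ^ (b i) := by
      intro s
      rw [← Finset.sum_sdiff hJS, left_eq_add]
      calc ∑ i ∈ J, w i * s ^ (a i) * Real.log s ^ (b i)
          = ∑ i ∈ J, w i * (s ^ a₀ * Real.log s ^ b₀) := by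
            refine Finset.sum_congr rfl fun i hi => ?_
            obtain ⟨-, hai, hbi⟩ := Finset.mem_filter.mp hi
            rw [hai, hbi, mul_assoc]
        _ = 0 := by rw [← Finset.sum_mul, hWJ, zero_mul]
    -- conclusion: the group of `i₁` is either the dominant group `J`, or a group of `S \ J`
    by_cases hJi₁ : a i₁ = a₀ ∧ b i₁ = b₀
    · have hfilt : (S.filter fun i => a i = a i₁ ∧ b i = b i₁) = J := by
        rw [hJ_def, hJi₁.1, hJi₁.2]
      rw [hfilt]
      exact hWJ
    · have hi₁SJ : i₁ ∈ S \ J :=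
        Finset.mem_sdiff.mpr ⟨hi₁S, fun hJ => hJi₁ (Finset.mem_filter.mp hJ).2⟩
      have key := ih (S \ J) (Finset.sdiff_ssubset hJS hJne)
        (fun i hi => hab i (Finset.sdiff_subset hi)) (h.congr fun s => (hsplit s).symm) i₁ hi₁SJ
      rw [← key]
      refine Finset.sum_congr ?_ fun _ _ => rfl
      ext i
      simp only [Finset.mem_filter, Finset.mem_sdiff]
      constructor
      · rintro ⟨hiS, hai, hbi⟩
        exact ⟨⟨hiS, fun hJ => hJi₁ ⟨hai.symm.trans (Finset.mem_filter.mp hJ).2.1,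
          hbi.symm.trans (Finset.mem_filter.mp hJ).2.2⟩⟩, hai, hbi⟩
      · rintro ⟨⟨hiS, -⟩, hai, hbi⟩
        exact ⟨hiS, hai, hbi⟩

/-- **Stub S2b — grouped coefficients of divergent log-power monomials vanish.**
If a finite real combination `∑ i, w i * s^(a i) * (log s)^(b i)` (`i : Fin k`) of DIVERGENT
monomials (`a i < 0`, or `a i = 0 ∧ 0 < b i`) has a finite limit `c` along some non-trivial filter
`l` finer than `𝓝[>] 0` (e.g. `𝓝[>] 0 ⊓ ae volume`), then for every index `i₀` the total
coefficient `∑ i with (a i, b i) = (a i₀, b i₀), w i` of the monomial of `i₀` vanishes.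
The `Fintype`-sum specialisation (`S = Finset.univ`) of
`sum_filter_eq_zero_of_tendsto_sum_divergentMonomials_of_le`, with the instance argument
`l.NeBot` made an explicit hypothesis as the crux skeleton states it (dominant-monomial induction
of `Literature.Analysis.Asymptotics.eq_zero_of_tendsto_sum_divergentMonomials` run along `l`;
Kaiser 2017, Lemma 4.6 / Prop. 4.7). [Kaiser 2017, Prop. 4.7] [folklore] -/
theorem stub_divergentMonomials_coeff_eq_zero :
    ∀ (k : ℕ) (a : Fin k → ℝ) (b : Fin k → ℕ) (w : Fin k → ℝ) (l : Filter ℝ) (c : ℝ), l.NeBot → l ≤ nhdsWithin (0 : ℝ) (Set.Ioi 0) → (∀ i, a i < 0 ∨ (a i = 0 ∧ 0 < b i)) → Filter.Tendsto (fun s : ℝ => ∑ i, w i * s ^ (a i) * Real.log s ^ (b i)) l (nhds c) → ∀ i₀ : Fin k, ∑ i ∈ Finset.univ.filter (fun i => a i = a i₀ ∧ b i = b i₀), w i = 0 := by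
  intro _ _ _ _ _ _ hl hle hab h i₀
  haveI := hl
  exact sum_filter_eq_zero_of_tendsto_sum_divergentMonomials_of_le hle Finset.univ
    (fun i _ => hab i) h i₀ (Finset.mem_univ _)

end Summit.KontsevichZagierPeriods.ValuedFieldSpecialisation
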